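import Summits.SmoothPoincare4.SmoothPoincare4.Theorems.ConvexBisectionAcyclicBisectionExistsHurwitzReduction
import Summits.SmoothPoincare4.SmoothPoincare4.Theorems.ConvexBisectionAcyclicBisectionExistsBeltPageClause
import Summits.SmoothPoincare4.SmoothPoincare4.Theorems.ConvexBisectionAcyclicBisectionExistsStabBlockMoves
import Literature.Topology.FourManifolds.GluingProofs
import HarnessLib

/-!
# N3 (`stub_STgeo`) from the NATURAL front stabilisation and (HS): the reduction of the registered
# rebuild statement to a model-level statement with the natural block
(wave 6, brick G5-2 of stub `stub_STgeo` = node N3 of NF4 `stub_modelsOnFibred_of_reach`, line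
`modp-braid-orbits`, crux `ConvexBisection.AcyclicBisectionExists`, item stmt-SmoothPoincare4-10508;
registered sub-goal `helper_st_front_of_natural`; design file `work/design/N3_Stabilisation_Design.lean`)

Companion of `…StabRebuildReduction.lean` (W6, p135224: (ST-front) from (ST-geo)) and
`…HurwitzReduction.lean` (W6, p134969: (HS) from (M2-geo) ∧ (BELT)).  The N3 design of wave 6 proves
the registered rebuild statement (ST-geo) not directly but through the Etnyre–Fuller two-sided
stabilisation, whose honest output is a fibred model of the SAME manifold with the NATURAL block
`(a,+)(a,−)(b,+)(b,−)`, `a = newE g + embed g c`, `b = newF g` (each traded dual lands in the page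
adjacent to its partner); the registered block `stabBlock g c = (a,+)(b,+)(b,−)(a,−)` is two signed
Hurwitz moves away (`hurwitzSteps_natBlock_stabBlock_front`, p165085).  This file is the bookkeeping
around that geometric core:

* `st_front_of_natural` / registered `helper_st_front_of_natural` — **(ST-front) at model level from
  (ST-nat) and (HS)**: the natural stabilised model followed by the two moves.
* `stgeo_of_st_front` — **the registered text of `stub_STgeo` (data level, "every gluing of the old
  data is diffeomorphic to every gluing of the new data") from the model-level (ST-front)**: glue the
  old data once (`exists_isBoundaryGluing_holds`), a fibred model by `modelsOnFibred_of_data`;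
  stabilise it; unpack; uniqueness of gluings (`nonempty_diffeomorph_of_isBoundaryGluing_holds`) on
  both sides.
* `stgeo_of_natural_of_hs`, `stgeo_of_natural_of_M2geo` — the registered text from (ST-nat) and (HS),
  resp. from (ST-nat) and (M2-geo) = `stub_M2geo` (through p134969 and the landed belt clause
  `helper_belt_pageClause` = N2).  So after this file: `stub_STgeo ⟸ (ST-nat) ∧ stub_M2geo`.

Everything is proved; no definitions, no named facts, no `sorry`.  References: J. B. Etnyre,
T. Fuller, IMRN 2006, §2 p. 5 [EtnyreFuller2006]; R. İ. Baykur, AGT 6 (2006), Lemma 1 and §5 p. 13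
[Baykur2006]; M. W. Hirsch, *Differential Topology* (1976), Ch. 8 §2 [HirschDT1976].
-/

noncomputable section

-- the prescribed namespace `Summit.<P>.<Sub>.…` duplicates `SmoothPoincare4` (P = Sub)
set_option linter.dupNamespace false

open scoped Manifold ContDiff Topology
open Set Function

namespace Summit.SmoothPoincare4.SmoothPoincare4.Theorems.AcyclicBisectionExists.ModpBraidOrbits

open Literature.GroupTheory.CombinatorialGroupTheory.SignedHurwitz
open Literature.Topology.FourManifolds Literature.Topology.FourManifolds.LefschetzBase
open Literature.Topology.FourManifolds.HandleAttachingMap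
open ModelsOnFibredOfReach

namespace StabNaturalReduction

/-- **(ST-front) at model level from the natural stabilisation (ST-nat) and (HS)**: stabilise with
the natural block `(a,+)(a,−)(b,+)(b,−)`, then apply the two signed Hurwitz moves of
`StabBlockMoves.hurwitzSteps_natBlock_stabBlock_front`. [cite: Baykur2006, Lemma 1] -/
theorem st_front_of_natural
    (hnat : ∀ (M : Type) [TopologicalSpace M] [T2Space M] [SecondCountableTopology M]
      [ChartedSpace (EuclideanSpace ℝ (Fin 4)) M] [IsManifold (𝓡 4) ∞ M] (g : ℕ) (l : IntWord g)
      (c : Fin g ⊕ Fin g → ℤ), (c = 0 ∨ IsPrimitive c) → ModelsOnFibred M g l →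
      ModelsOnFibred M (g + 1) ((newE g + embed g c, true) :: (newE g + embed g c, false) ::
        (newF g, true) :: (newF g, false) :: mapWord (embed g) l))
    (hs : ∀ (M : Type) [TopologicalSpace M] [T2Space M] [SecondCountableTopology M]
      [ChartedSpace (EuclideanSpace ℝ (Fin 4)) M] [IsManifold (𝓡 4) ∞ M] (g : ℕ) (l l' : IntWord g),
      ModelsOnFibred M g l → HurwitzStep (stdSymp ℤ g) l l' → ModelsOnFibred M g l') :
    ∀ (M : Type) [TopologicalSpace M] [T2Space M] [SecondCountableTopology M]
      [ChartedSpace (EuclideanSpace ℝ (Fin 4)) M] [IsManifold (𝓡 4) ∞ M] (g : ℕ) (l : IntWord g)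
      (c : Fin g ⊕ Fin g → ℤ), (c = 0 ∨ IsPrimitive c) →
      ModelsOnFibred M g l → ModelsOnFibred M (g + 1) (stabBlock g c ++ mapWord (embed g) l) := by
  intro M _ _ _ _ _ g l c hc hM
  obtain ⟨l₁, h₁, h₂⟩ := StabBlockMoves.hurwitzSteps_natBlock_stabBlock_front c l
  exact hs M (g + 1) _ _ (hs M (g + 1) _ _ (hnat M g l c hc hM) h₁) h₂

/-- **The registered text of `stub_STgeo` from a MODEL-level front stabilisation.**  The data-level
clause "all gluings of the old data are diffeomorphic to all gluings of the new data" is recovered by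
gluing the old data once: `P₀ := X ∪_Ψ Base g` (`exists_isBoundaryGluing_holds`) is a fibred model
(`modelsOnFibred_of_data`); stabilise `P₀`; unpack its new fibred data; any gluing `M` of the old
data and any gluing `M'` of the new data are diffeomorphic to `P₀`
(`nonempty_diffeomorph_of_isBoundaryGluing_holds`, Hirsch 1976 Ch. 8 §2).
[cite: HirschDT1976, Ch. 8 §2] -/
theorem stgeo_of_st_front
    (hst : ∀ (M : Type) [TopologicalSpace M] [T2Space M] [SecondCountableTopology M]
      [ChartedSpace (EuclideanSpace ℝ (Fin 4)) M] [IsManifold (𝓡 4) ∞ M] (g : ℕ) (l : IntWord g)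
      (c : Fin g ⊕ Fin g → ℤ), (c = 0 ∨ IsPrimitive c) →
      ModelsOnFibred M g l → ModelsOnFibred M (g + 1) (stabBlock g c ++ mapWord (embed g) l)) :
    ∀ (g : ℕ) (l : IntWord g) (c : Fin g ⊕ Fin g → ℤ), (c = 0 ∨ IsPrimitive c) →
      ∀ (X : Type) [TopologicalSpace X] [T2Space X] [SecondCountableTopology X] [CompactSpace X]
        [ChartedSpace (EuclideanHalfSpace 4) X] [IsManifold (𝓡∂ 4) ∞ X]
        (h : Fin l.length → HandleAttachingMap 3 2 (Base g))
        (D : MultiAttachmentData h (𝓡∂ 4) X) (bX : BoundaryData (𝓡∂ 4) X (𝓡 3))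
        (Ψ : bX.carrier ≃ₘ⟮𝓡 3, 𝓡 3⟯ (bBase g).carrier),
        IsLefschetzLink g l h →
        (∀ (y : bX.carrier) (a : ↥(coresComplement h)), bX.incl y = D.jA a →
          ∃ c : ℝ, 0 < c ∧ w g ((bBase g).incl (Ψ y)).1 = (c : ℂ) * w g (a : Base g).1) →
        ∃ (X' : Type) (_ : TopologicalSpace X') (_ : T2Space X') (_ : SecondCountableTopology X')
          (_ : CompactSpace X') (_ : ChartedSpace (EuclideanHalfSpace 4) X')
          (_ : IsManifold (𝓡∂ 4) ∞ X')
          (h' : Fin (stabBlock g c ++ mapWord (embed g) l).length →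
            HandleAttachingMap 3 2 (Base (g + 1)))
          (D' : MultiAttachmentData h' (𝓡∂ 4) X') (bX' : BoundaryData (𝓡∂ 4) X' (𝓡 3))
          (Ψ' : bX'.carrier ≃ₘ⟮𝓡 3, 𝓡 3⟯ (bBase (g + 1)).carrier),
          IsLefschetzLink (g + 1) (stabBlock g c ++ mapWord (embed g) l) h' ∧
          (∀ (y : bX'.carrier) (a : ↥(coresComplement h')), bX'.incl y = D'.jA a →
            ∃ c' : ℝ, 0 < c' ∧
              w (g + 1) ((bBase (g + 1)).incl (Ψ' y)).1 = (c' : ℂ) * w (g + 1) (a : Base (g + 1)).1) ∧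
          ∀ (M M' : Type) [TopologicalSpace M] [ChartedSpace (EuclideanSpace ℝ (Fin 4)) M]
            [IsManifold (𝓡 4) ∞ M] [TopologicalSpace M'] [ChartedSpace (EuclideanSpace ℝ (Fin 4)) M']
            [IsManifold (𝓡 4) ∞ M'],
            IsBoundaryGluing bX (bBase g) Ψ (𝓡 4) M → IsBoundaryGluing bX' (bBase (g + 1)) Ψ' (𝓡 4) M' →
            Nonempty (M ≃ₘ⟮𝓡 4, 𝓡 4⟯ M') := by
  intro g l c hc X _ _ _ _ _ _ h D bX Ψ hlink hpage
  -- glue the old data once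
  obtain ⟨P₀, _, _, _, _, _, _, hglue₀⟩ := exists_isBoundaryGluing_holds bX (bBase g) Ψ
  have hP₀ : ModelsOnFibred P₀ g l := modelsOnFibred_of_data hlink D bX Ψ hglue₀ hpage
  -- stabilise the glued manifold at model level and unpack
  obtain ⟨X', _, _, _, _, _, _, h', D', bX', Ψ', hlink', hglue', hpage'⟩ := hst P₀ g l c hc hP₀
  refine ⟨X', inferInstance, inferInstance, inferInstance, inferInstance, inferInstance,
    inferInstance, h', D', bX', Ψ', hlink', hpage', ?_⟩
  intro M M' _ _ _ _ _ _ hM hM'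
  obtain ⟨e₁⟩ := nonempty_diffeomorph_of_isBoundaryGluing_holds hM hglue₀
  obtain ⟨e₂⟩ := nonempty_diffeomorph_of_isBoundaryGluing_holds hglue' hM'
  exact ⟨e₁.trans e₂⟩

/-- **The registered text of `stub_STgeo` from (ST-nat) and (HS).** [cite: EtnyreFuller2006, §2] -/
theorem stgeo_of_natural_of_hs
    (hnat : ∀ (M : Type) [TopologicalSpace M] [T2Space M] [SecondCountableTopology M] [ChartedSpace (EuclideanSpace ℝ (Fin 4)) M] [IsManifold (𝓡 4) ∞ M] (g : ℕ) (l : Literature.GroupTheory.CombinatorialGroupTheory.SignedHurwitz.IntWord g) (c : Fin g ⊕ Fin g → ℤ), (c = 0 ∨ Literature.GroupTheory.CombinatorialGroupTheory.SignedHurwitz.IsPrimitive c) → Literature.Topology.FourManifolds.LefschetzBase.ModelsOnFibred M g l → Literature.Topology.FourManifolds.LefschetzBase.ModelsOnFibred M (g + 1) ((Literature.GroupTheory.CombinatorialGroupTheory.SignedHurwitz.newE g + Literature.GroupTheory.CombinatorialGroupTheory.SignedHurwitz.embed g c, true) :: (Literature.GroupTheory.CombinatorialGroupTheory.SignedHurwitz.newE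 g + Literature.GroupTheory.CombinatorialGroupTheory.SignedHurwitz.embed g c, false) :: (Literature.GroupTheory.CombinatorialGroupTheory.SignedHurwitz.newF g, true) :: (Literature.GroupTheory.CombinatorialGroupTheory.SignedHurwitz.newF g, false) :: Literature.GroupTheory.CombinatorialGroupTheory.SignedHurwitz.mapWord (Literature.GroupTheory.CombinatorialGroupTheory.SignedHurwitz.embed g) l))
    (hs : ∀ (M : Type) [TopologicalSpace M] [T2Space M] [SecondCountableTopology M] [ChartedSpace (EuclideanSpace ℝ (Fin 4)) M] [IsManifold (𝓡 4) ∞ M] (g : ℕ) (l l' : Literature.GroupTheory.CombinatorialGroupTheory.SignedHurwitz.IntWord g), Literature.Topology.FourManifolds.LefschetzBase.ModelsOnFibred M g l → Literature.GroupTheory.CombinatorialGroupTheory.SignedHurwitz.HurwitzStep (Literature.GroupTheory.CombinatorialGroupTheory.SignedHurwitz.stdSymp ℤ g) l l' → Literature.Topology.FourManifolds.LefschetzBase.ModelsOnFibred M g l') :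
    ∀ (g : ℕ) (l : Literature.GroupTheory.CombinatorialGroupTheory.SignedHurwitz.IntWord g) (c : Fin g ⊕ Fin g → ℤ), (c = 0 ∨ Literature.GroupTheory.CombinatorialGroupTheory.SignedHurwitz.IsPrimitive c) → ∀ (X : Type) [TopologicalSpace X] [T2Space X] [SecondCountableTopology X] [CompactSpace X] [ChartedSpace (EuclideanHalfSpace 4) X] [IsManifold (𝓡∂ 4) ∞ X] (h : Fin l.length → Literature.Topology.FourManifolds.HandleAttachingMap 3 2 (Literature.Topology.FourManifolds.LefschetzBase.Base g)) (D : Literature.Topology.FourManifolds.HandleAttachingMap.MultiAttachmentData h (𝓡∂ 4) X) (bX : Literature.Topology.FourManifolds.BoundaryData (𝓡∂ 4) X (𝓡 3)) (Ψ : bX.carrier ≃ₘ⟮𝓡 3, 𝓡 3⟯ (Literature.Topology.FourManifolds.LefschetzBase.bBase g).carrier), Literature.Topology.FourManifolds.LefschetzBase.IsLefschetzLink g l h → (∀ (y : bX.carrier) (a : ↥(Literature.Topology.FourManifolds.HandleAttachingMap.coresComplement h)), bX.incl y = D.jA a → ∃ c : ℝ, 0 < c ∧ Literature.Topology.FourManifolds.LefschetzBase.w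 g ((Literature.Topology.FourManifolds.LefschetzBase.bBase g).incl (Ψ y)).1 = (c : ℂ) * Literature.Topology.FourManifolds.LefschetzBase.w g (a : Literature.Topology.FourManifolds.LefschetzBase.Base g).1) → ∃ (X' : Type) (_ : TopologicalSpace X') (_ : T2Space X') (_ : SecondCountableTopology X') (_ : CompactSpace X') (_ : ChartedSpace (EuclideanHalfSpace 4) X') (_ : IsManifold (𝓡∂ 4) ∞ X') (h' : Fin (Literature.GroupTheory.CombinatorialGroupTheory.SignedHurwitz.stabBlock g c ++ Literature.GroupTheory.CombinatorialGroupTheory.SignedHurwitz.mapWord (Literature.GroupTheory.CombinatorialGroupTheory.SignedHurwitz.embed g) l).length → Literature.Topology.FourManifolds.HandleAttachingMap 3 2 (Literature.Topology.FourManifolds.LefschetzBase.Base (g + 1))) (D' : Literature.Topology.FourManifolds.HandleAttachingMap.MultiAttachmentData h' (𝓡∂ 4) X') (bX' : Literature.Topology.FourManifolds.BoundaryData (𝓡∂ 4) X' (𝓡 3)) (Ψ' : bX'.carrier ≃ₘ⟮𝓡 3, 𝓡 3⟯ (Literature.Topology.FourManifolds.LefschetzBase.bBase (g + 1)).carrier),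 Literature.Topology.FourManifolds.LefschetzBase.IsLefschetzLink (g + 1) (Literature.GroupTheory.CombinatorialGroupTheory.SignedHurwitz.stabBlock g c ++ Literature.GroupTheory.CombinatorialGroupTheory.SignedHurwitz.mapWord (Literature.GroupTheory.CombinatorialGroupTheory.SignedHurwitz.embed g) l) h' ∧ (∀ (y : bX'.carrier) (a : ↥(Literature.Topology.FourManifolds.HandleAttachingMap.coresComplement h')), bX'.incl y = D'.jA a → ∃ c' : ℝ, 0 < c' ∧ Literature.Topology.FourManifolds.LefschetzBase.w (g + 1) ((Literature.Topology.FourManifolds.LefschetzBase.bBase (g + 1)).incl (Ψ' y)).1 = (c' : ℂ) * Literature.Topology.FourManifolds.LefschetzBase.w (g + 1) (a : Literature.Topology.FourManifolds.LefschetzBase.Base (g + 1)).1) ∧ ∀ (M M' : Type) [TopologicalSpace M] [ChartedSpace (EuclideanSpace ℝ (Fin 4)) M] [IsManifold (𝓡 4) ∞ M] [TopologicalSpace M'] [ChartedSpace (EuclideanSpace ℝ (Fin 4)) M'] [IsManifold (𝓡 4) ∞ M'], Literature.Topology.FourManifolds.IsBoundaryGluing bX (Literature.Topology.FourManifolds.LefschetzBase.bBase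 g) Ψ (𝓡 4) M → Literature.Topology.FourManifolds.IsBoundaryGluing bX' (Literature.Topology.FourManifolds.LefschetzBase.bBase (g + 1)) Ψ' (𝓡 4) M' → Nonempty (M ≃ₘ⟮𝓡 4, 𝓡 4⟯ M') :=
  stgeo_of_st_front (st_front_of_natural hnat hs)

/-- **The registered text of `stub_STgeo` from (ST-nat) and (M2-geo) = `stub_M2geo`**: (HS) from
(M2-geo) and the LANDED belt clause `helper_belt_pageClause` (N2) through
`redecomposition_of_geometric_of_belt` and `hurwitzStep_of_redecomposition` (p134969).  This is how
the N3 design of wave 6 discharges `stub_STgeo`: by proving (ST-nat). [cite: Baykur2006, §5 p. 13] -/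
theorem stgeo_of_natural_of_M2geo
    (hnat : ∀ (M : Type) [TopologicalSpace M] [T2Space M] [SecondCountableTopology M] [ChartedSpace (EuclideanSpace ℝ (Fin 4)) M] [IsManifold (𝓡 4) ∞ M] (g : ℕ) (l : Literature.GroupTheory.CombinatorialGroupTheory.SignedHurwitz.IntWord g) (c : Fin g ⊕ Fin g → ℤ), (c = 0 ∨ Literature.GroupTheory.CombinatorialGroupTheory.SignedHurwitz.IsPrimitive c) → Literature.Topology.FourManifolds.LefschetzBase.ModelsOnFibred M g l → Literature.Topology.FourManifolds.LefschetzBase.ModelsOnFibred M (g + 1) ((Literature.GroupTheory.CombinatorialGroupTheory.SignedHurwitz.newE g + Literature.GroupTheory.CombinatorialGroupTheory.SignedHurwitz.embed g c, true) :: (Literature.GroupTheory.CombinatorialGroupTheory.SignedHurwitz.newE g + Literature.GroupTheory.CombinatorialGroupTheory.SignedHurwitz.embed g c, false) :: (Literature.GroupTheory.CombinatorialGroupTheory.SignedHurwitz.newF g, true) :: (Literature.GroupTheory.CombinatorialGroupTheory.SignedHurwitz.newF g, false) :: Literature.GroupTheory.CombinatorialGroupTheory.SignedHurwitz.mapWord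 (Literature.GroupTheory.CombinatorialGroupTheory.SignedHurwitz.embed g) l))
    (hM2 : ∀ (g : ℕ) (l l' : Literature.GroupTheory.CombinatorialGroupTheory.SignedHurwitz.IntWord g), Literature.GroupTheory.CombinatorialGroupTheory.SignedHurwitz.HurwitzStep (Literature.GroupTheory.CombinatorialGroupTheory.SignedHurwitz.stdSymp ℤ g) l l' → ∀ (X : Type) [TopologicalSpace X] [T2Space X] [SecondCountableTopology X] [CompactSpace X] [ChartedSpace (EuclideanHalfSpace 4) X] [IsManifold (𝓡∂ 4) ∞ X] (h : Fin l.length → Literature.Topology.FourManifolds.HandleAttachingMap 3 2 (Literature.Topology.FourManifolds.LefschetzBase.Base g)) (D : Literature.Topology.FourManifolds.HandleAttachingMap.MultiAttachmentData h (𝓡∂ 4) X) (bX : Literature.Topology.FourManifolds.BoundaryData (𝓡∂ 4) X (𝓡 3)) (Ψ : bX.carrier ≃ₘ⟮𝓡 3, 𝓡 3⟯ (Literature.Topology.FourManifolds.LefschetzBase.bBase g).carrier), Literature.Topology.FourManifolds.LefschetzBase.IsLefschetzLink g l h → (∀ (y : bX.carrier) (a : ↥(Literature.Topology.FourManifolds.HandleAttachingMap.coresComplement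 h)), bX.incl y = D.jA a → ∃ c : ℝ, 0 < c ∧ Literature.Topology.FourManifolds.LefschetzBase.w g ((Literature.Topology.FourManifolds.LefschetzBase.bBase g).incl (Ψ y)).1 = (c : ℂ) * Literature.Topology.FourManifolds.LefschetzBase.w g (a : Literature.Topology.FourManifolds.LefschetzBase.Base g).1) → ∃ (X' : Type) (_ : TopologicalSpace X') (_ : T2Space X') (_ : SecondCountableTopology X') (_ : CompactSpace X') (_ : ChartedSpace (EuclideanHalfSpace 4) X') (_ : IsManifold (𝓡∂ 4) ∞ X') (h' : Fin l'.length → Literature.Topology.FourManifolds.HandleAttachingMap 3 2 (Literature.Topology.FourManifolds.LefschetzBase.Base g)) (D' : Literature.Topology.FourManifolds.HandleAttachingMap.MultiAttachmentData h' (𝓡∂ 4) X') (G : X ≃ₘ⟮𝓡∂ 4, 𝓡∂ 4⟯ X'), Literature.Topology.FourManifolds.LefschetzBase.IsLefschetzLink g l' h' ∧ ∀ a' : ↥(Literature.Topology.FourManifolds.HandleAttachingMap.coresComplement h'), G.symm (D'.jA a') ∈ (𝓡∂ 4).boundary X → (∃ a : ↥(Literature.Topology.FourManifolds.HandleAttachingMap.coresComplement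 h), G.symm (D'.jA a') = D.jA a ∧ ∃ c : ℝ, 0 < c ∧ Literature.Topology.FourManifolds.LefschetzBase.w g (a' : Literature.Topology.FourManifolds.LefschetzBase.Base g).1 = (c : ℂ) * Literature.Topology.FourManifolds.LefschetzBase.w g (a : Literature.Topology.FourManifolds.LefschetzBase.Base g).1) ∨ (∃ (k : Fin l.length) (b : ↥(Literature.Topology.FourManifolds.beltPiece 3 2)), G.symm (D'.jA a') = D.jB k b ∧ G.symm (D'.jA a') ∉ Set.range D.jA ∧ ∃ c : ℝ, 0 < c ∧ Literature.Topology.FourManifolds.LefschetzBase.w g (a' : Literature.Topology.FourManifolds.LefschetzBase.Base g).1 = (c : ℂ) * Literature.Topology.FourManifolds.LefschetzBase.pageDir l.length k)) :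
    ∀ (g : ℕ) (l : Literature.GroupTheory.CombinatorialGroupTheory.SignedHurwitz.IntWord g) (c : Fin g ⊕ Fin g → ℤ), (c = 0 ∨ Literature.GroupTheory.CombinatorialGroupTheory.SignedHurwitz.IsPrimitive c) → ∀ (X : Type) [TopologicalSpace X] [T2Space X] [SecondCountableTopology X] [CompactSpace X] [ChartedSpace (EuclideanHalfSpace 4) X] [IsManifold (𝓡∂ 4) ∞ X] (h : Fin l.length → Literature.Topology.FourManifolds.HandleAttachingMap 3 2 (Literature.Topology.FourManifolds.LefschetzBase.Base g)) (D : Literature.Topology.FourManifolds.HandleAttachingMap.MultiAttachmentData h (𝓡∂ 4) X) (bX : Literature.Topology.FourManifolds.BoundaryData (𝓡∂ 4) X (𝓡 3)) (Ψ : bX.carrier ≃ₘ⟮𝓡 3, 𝓡 3⟯ (Literature.Topology.FourManifolds.LefschetzBase.bBase g).carrier), Literature.Topology.FourManifolds.LefschetzBase.IsLefschetzLink g l h → (∀ (y : bX.carrier) (a : ↥(Literature.Topology.FourManifolds.HandleAttachingMap.coresComplement h)), bX.incl y = D.jA a → ∃ c : ℝ, 0 < c ∧ Literature.Topology.FourManifolds.LefschetzBase.w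 g ((Literature.Topology.FourManifolds.LefschetzBase.bBase g).incl (Ψ y)).1 = (c : ℂ) * Literature.Topology.FourManifolds.LefschetzBase.w g (a : Literature.Topology.FourManifolds.LefschetzBase.Base g).1) → ∃ (X' : Type) (_ : TopologicalSpace X') (_ : T2Space X') (_ : SecondCountableTopology X') (_ : CompactSpace X') (_ : ChartedSpace (EuclideanHalfSpace 4) X') (_ : IsManifold (𝓡∂ 4) ∞ X') (h' : Fin (Literature.GroupTheory.CombinatorialGroupTheory.SignedHurwitz.stabBlock g c ++ Literature.GroupTheory.CombinatorialGroupTheory.SignedHurwitz.mapWord (Literature.GroupTheory.CombinatorialGroupTheory.SignedHurwitz.embed g) l).length → Literature.Topology.FourManifolds.HandleAttachingMap 3 2 (Literature.Topology.FourManifolds.LefschetzBase.Base (g + 1))) (D' : Literature.Topology.FourManifolds.HandleAttachingMap.MultiAttachmentData h' (𝓡∂ 4) X') (bX' : Literature.Topology.FourManifolds.BoundaryData (𝓡∂ 4) X' (𝓡 3)) (Ψ' : bX'.carrier ≃ₘ⟮𝓡 3, 𝓡 3⟯ (Literature.Topology.FourManifolds.LefschetzBase.bBase (g + 1)).carrier),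 Literature.Topology.FourManifolds.LefschetzBase.IsLefschetzLink (g + 1) (Literature.GroupTheory.CombinatorialGroupTheory.SignedHurwitz.stabBlock g c ++ Literature.GroupTheory.CombinatorialGroupTheory.SignedHurwitz.mapWord (Literature.GroupTheory.CombinatorialGroupTheory.SignedHurwitz.embed g) l) h' ∧ (∀ (y : bX'.carrier) (a : ↥(Literature.Topology.FourManifolds.HandleAttachingMap.coresComplement h')), bX'.incl y = D'.jA a → ∃ c' : ℝ, 0 < c' ∧ Literature.Topology.FourManifolds.LefschetzBase.w (g + 1) ((Literature.Topology.FourManifolds.LefschetzBase.bBase (g + 1)).incl (Ψ' y)).1 = (c' : ℂ) * Literature.Topology.FourManifolds.LefschetzBase.w (g + 1) (a : Literature.Topology.FourManifolds.LefschetzBase.Base (g + 1)).1) ∧ ∀ (M M' : Type) [TopologicalSpace M] [ChartedSpace (EuclideanSpace ℝ (Fin 4)) M] [IsManifold (𝓡 4) ∞ M] [TopologicalSpace M'] [ChartedSpace (EuclideanSpace ℝ (Fin 4)) M'] [IsManifold (𝓡 4) ∞ M'], Literature.Topology.FourManifolds.IsBoundaryGluing bX (Literature.Topology.FourManifolds.LefschetzBase.bBase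 g) Ψ (𝓡 4) M → Literature.Topology.FourManifolds.IsBoundaryGluing bX' (Literature.Topology.FourManifolds.LefschetzBase.bBase (g + 1)) Ψ' (𝓡 4) M' → Nonempty (M ≃ₘ⟮𝓡 4, 𝓡 4⟯ M') :=
  stgeo_of_natural_of_hs hnat
    (hurwitzStep_of_redecomposition (redecomposition_of_geometric_of_belt hM2 helper_belt_pageClause))

end StabNaturalReduction

/-! ## Registered helper -/

/-- **Registered helper `helper_st_front_of_natural` (sub-goal of `stub_STgeo`, wave 6, lead c5):
(ST-front) at model level — `ModelsOnFibred M g l → ModelsOnFibred M (g+1) (stabBlock g c ++ embed l)`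
for a primitive-or-zero arc class `c` — follows from the NATURAL front stabilisation (ST-nat, block
`(a,+)(a,−)(b,+)(b,−)`, the geometric core of the N3 design) and the invariance (HS) of fibred models
under one signed Hurwitz move, by the two moves of `hurwitzSteps_natBlock_stabBlock_front`.**
[cite: Baykur2006, Lemma 1] -/
theorem helper_st_front_of_natural : (∀ (M : Type) [TopologicalSpace M] [T2Space M] [SecondCountableTopology M] [ChartedSpace (EuclideanSpace ℝ (Fin 4)) M] [IsManifold (𝓡 4) ∞ M] (g : ℕ) (l : Literature.GroupTheory.CombinatorialGroupTheory.SignedHurwitz.IntWord g) (c : Fin g ⊕ Fin g → ℤ), (c = 0 ∨ Literature.GroupTheory.CombinatorialGroupTheory.SignedHurwitz.IsPrimitive c) → Literature.Topology.FourManifolds.LefschetzBase.ModelsOnFibred M g l → Literature.Topology.FourManifolds.LefschetzBase.ModelsOnFibred M (g + 1) ((Literature.GroupTheory.CombinatorialGroupTheory.SignedHurwitz.newE g + Literature.GroupTheory.CombinatorialGroupTheory.SignedHurwitz.embed g c, true) :: (Literature.GroupTheory.CombinatorialGroupTheory.SignedHurwitz.newE g + Literature.GroupTheory.CombinatorialGroupTheory.SignedHurwitz.embed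 g c, false) :: (Literature.GroupTheory.CombinatorialGroupTheory.SignedHurwitz.newF g, true) :: (Literature.GroupTheory.CombinatorialGroupTheory.SignedHurwitz.newF g, false) :: Literature.GroupTheory.CombinatorialGroupTheory.SignedHurwitz.mapWord (Literature.GroupTheory.CombinatorialGroupTheory.SignedHurwitz.embed g) l)) → (∀ (M : Type) [TopologicalSpace M] [T2Space M] [SecondCountableTopology M] [ChartedSpace (EuclideanSpace ℝ (Fin 4)) M] [IsManifold (𝓡 4) ∞ M] (g : ℕ) (l l' : Literature.GroupTheory.CombinatorialGroupTheory.SignedHurwitz.IntWord g), Literature.Topology.FourManifolds.LefschetzBase.ModelsOnFibred M g l → Literature.GroupTheory.CombinatorialGroupTheory.SignedHurwitz.HurwitzStep (Literature.GroupTheory.CombinatorialGroupTheory.SignedHurwitz.stdSymp ℤ g) l l' → Literature.Topology.FourManifolds.LefschetzBase.ModelsOnFibred M g l') → ∀ (M : Type) [TopologicalSpace M] [T2Space M] [SecondCountableTopology M] [ChartedSpace (EuclideanSpace ℝ (Fin 4)) M] [IsManifold (𝓡 4) ∞ M] (g : ℕ) (l : Literature.GroupTheory.CombinatorialGroupTheory.SignedHurwitz.IntWord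 g) (c : Fin g ⊕ Fin g → ℤ), (c = 0 ∨ Literature.GroupTheory.CombinatorialGroupTheory.SignedHurwitz.IsPrimitive c) → Literature.Topology.FourManifolds.LefschetzBase.ModelsOnFibred M g l → Literature.Topology.FourManifolds.LefschetzBase.ModelsOnFibred M (g + 1) (Literature.GroupTheory.CombinatorialGroupTheory.SignedHurwitz.stabBlock g c ++ Literature.GroupTheory.CombinatorialGroupTheory.SignedHurwitz.mapWord (Literature.GroupTheory.CombinatorialGroupTheory.SignedHurwitz.embed g) l) :=
  fun hnat hs => StabNaturalReduction.st_front_of_natural hnat hs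

end Summit.SmoothPoincare4.SmoothPoincare4.Theorems.AcyclicBisectionExists.ModpBraidOrbits

end
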